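import Literature.Probability.LatticeModels.ButterflyPeriodicity
import Literature.Probability.LatticeModels.IsingClusterUniqueness
import Literature.Probability.LatticeModels.ZhangCrossing
import HarnessLib

/-!
# The butterfly lemma (Georgii–Higuchi 2000, Lemma 3.1) for coexisting tail-trivial states

Topic `Probability/LatticeModels`. Georgii–Higuchi, J. Math. Phys. 41 (2000), Lemma 3.1 (butterfly
lemma): "`𝒢`-almost surely there exists at least one infinite butterfly", i.e. a pair of infinite
clusters of the same sign in two conjugate half-planes. We prove the case that the non-coexistence
proof needs: **a tail-trivial `μ ∈ 𝒢(β, 0)` on `ℤ²` (`β ≥ 0`) under which both an infinite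
`+`cluster and an infinite `-`cluster exist almost surely has an infinite butterfly across one of
the lines `{x_i = k}`, `i ∈ {0, 1}`, `k ∈ {0, 1}`** (`exists_infinite_butterfly`).

The proof is the printed one (pp. 7–8). Suppose there is no such butterfly. Step 1
(`ReflectionInvarianceStep`, `ButterflyPeriodicity`): `μ` is `R∘T`-invariant for the reflections in
the two axes and `2ℤ²`-periodic. Step 2: by Burton–Keane (`IsingClusterUniqueness`) the infinite
`+`cluster and the infinite `-`cluster are a.s. unique. Fix a square `Λ = Λ_m` met by the infinite
`+`cluster with probability `> 1 - 2⁻¹²`, and a larger square `B = Λ_N` in which, with probability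
`> 7/8`, any two sites of `Λ` in the infinite `±`cluster are already `±`connected (local form of
uniqueness). Let `A⁺_k` be the increasing event that some site of `Λ` in the infinite `+`cluster is
`+`connected inside `B` to the `k`-th closed-quadrant part `∂_kB` of `∂B` (GH's `A⁺_k`, with the
infinite `+`path in `Λᶜ` replaced by its trace in `B`; the union over `k` still covers
`{Λ ∩ I⁺ ≠ ∅}`). Positive correlations (`TailTrivialGibbs`) give `∏_k μ(Ω∖A⁺_k) < 2⁻¹²`, so some
`μ(Ω∖A⁺_k) < 2⁻³`; the flip-reflection symmetries give `μ(A⁺_k ∩ A⁻_{k'} ∩ A⁺_{-k} ∩ A⁻_{k''}) > 1/2`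
for the two quadrants `k', k''` adjacent to `k`, and on this event intersected with local uniqueness
there are a `+`path inside `B` between opposite quadrant arcs of `∂B` and a `-`path inside `B`
between the other two — impossible by Zhang's crossing obstruction (`ZhangCrossing`).

## References

* H.-O. Georgii, Y. Higuchi, J. Math. Phys. 41 (2000) 1153–1169, Lemma 3.1 and its proof,
  pp. 7–8 [GeorgiiHiguchi2000].
-/

noncomputable section

open MeasureTheory Filter Topology Finset SimpleGraph
open Literature.Probability.Percolation (siteCluster siteOpenGraph siteOpenGraph_adj siteOpenGraph_mono
  sitePercolatesAt withinGraph withinGraph_adj exists_adj_reachable_withinGraph_of_walk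
  siteCluster_relabel stepKind_of_adj)
open scoped ENNReal

namespace Literature.Probability.LatticeModels

/-! ### Walks in the `s`-subgraph -/

section Graph

variable {V : Type*} {G : SimpleGraph V}

/-- All vertices of a walk in the subgraph induced on `O` lie in `O`, provided its start does. [folklore] -/
theorem support_subset_of_walk_siteOpenGraph {O : Set V} :
    ∀ {u v : V} (p : (siteOpenGraph G O).Walk u v), u ∈ O → ∀ z ∈ p.support, z ∈ O
  | _, _, Walk.nil, hu, z, hz => by
    rw [Walk.support_nil, List.mem_singleton] at hz; exact hz ▸ hu
  | _, _, Walk.cons hadj p', _, z, hz => by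
    rw [Walk.support_cons, List.mem_cons] at hz
    have ha := (siteOpenGraph_adj G O _ _).1 hadj
    rcases hz with rfl | hz
    · exact ha.2.1
    · exact support_subset_of_walk_siteOpenGraph p' ha.2.2 z hz

/-- A walk of `G` through vertices of `O` is a walk of the subgraph induced on `O`. [folklore] -/
theorem siteOpenGraph_reachable_of_walk {O : Set V} {u v : V} (p : G.Walk u v)
    (hp : ∀ z ∈ p.support, z ∈ O) : (siteOpenGraph G O).Reachable u v := by
  refine ⟨p.transfer (siteOpenGraph G O) fun e he => ?_⟩
  induction e using Sym2.ind with
  | h a b =>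
    rw [mem_edgeSet, siteOpenGraph_adj]
    exact ⟨p.adj_of_mem_edges he, hp a (p.fst_mem_support_of_mem_edges he),
      hp b (p.snd_mem_support_of_mem_edges he)⟩

/-- Restricting the `s`-subgraph to `S` is the subgraph induced on `O ∩ S`. [folklore] -/
theorem withinGraph_siteOpenGraph (O S : Set V) :
    withinGraph (siteOpenGraph G O) S = siteOpenGraph G (O ∩ S) := by
  ext u v
  simp only [withinGraph_adj, siteOpenGraph_adj, Set.mem_inter_iff]
  tauto

/-- Site clusters grow with the set of open sites. [folklore] -/
theorem siteCluster_mono {O O' : Set V} (h : O ⊆ O') (x : V) :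
    siteCluster G O x ⊆ siteCluster G O' x := fun _ ⟨hx, hy, hr⟩ =>
  ⟨h hx, h hy, hr.mono (siteOpenGraph_mono G h)⟩

end Graph

/-! ### The events of Step 2 -/

section Events

/-- The part `∂_qΛ_N` of the boundary of `Λ_N = [-N, N]²` in the closed quadrant of signs
`q = (q₁, q₂)` (Georgii–Higuchi 2000, p. 7: "`∂_kΛ` the intersection of `∂Λ` with the `k`'th
quadrant"), in coordinates. [cite: GeorgiiHiguchi2000, Lemma 3.1 (proof, Step 2, p. 7)] -/
def quadArc (q : ℤˣ × ℤˣ) (N : ℕ) : Set (Site 2) :=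
  {e | ((q.1 : ℤ) * e 0 = N ∧ 0 ≤ (q.2 : ℤ) * e 1) ∨ ((q.2 : ℤ) * e 1 = N ∧ 0 ≤ (q.1 : ℤ) * e 0)}

/-- `x` and `e` are joined by a path of `s`-sites inside `Λ_N`. [cite: GeorgiiHiguchi2000, Lemma 3.1 (proof, Step 2, p. 7)] -/
def boxConn (s : ℤˣ) (N : ℕ) (ω : SpinConfig (Site 2)) (x e : Site 2) : Prop :=
  (siteOpenGraph (zdGraph 2) (spinSites s ω ∩ ↑(box 2 N))).Reachable x e

/-- The **arm event** `A^s(T)`: some site of `Λ_m` with an infinite `s`-cluster is joined by a path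
of `s`-sites inside `Λ_N` to a site of `T` (for `T = ∂_qΛ_N` this is Georgii–Higuchi's `A^±_k`,
p. 7, with the infinite `s`-path in `Λᶜ` replaced by its trace inside the larger square). [cite: GeorgiiHiguchi2000, Lemma 3.1 (proof, Step 2, p. 7)] -/
def quadArmEvent (s : ℤˣ) (m N : ℕ) (T : Set (Site 2)) : Set (SpinConfig (Site 2)) :=
  {ω | ∃ x ∈ box 2 m, (siteCluster (zdGraph 2) (spinSites s ω) x).Infinite ∧ ∃ e ∈ T, boxConn s N ω x e}

/-- **Local uniqueness**: any two sites of `Λ_m` with infinite `s`-clusters are joined by a path of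
`s`-sites inside `Λ_N` (the finite-volume trace of "there exists a unique infinite `s`-cluster"). [cite: GeorgiiHiguchi2000, Lemma 3.1 (proof, Step 2, p. 7)] -/
def localUnique (s : ℤˣ) (m N : ℕ) : Set (SpinConfig (Site 2)) :=
  {ω | ∀ x ∈ box 2 m, ∀ y ∈ box 2 m, (siteCluster (zdGraph 2) (spinSites s ω) x).Infinite →
    (siteCluster (zdGraph 2) (spinSites s ω) y).Infinite → boxConn s N ω x y}

/-- `{C^s(x) infinite}` is measurable. [folklore] -/
theorem measurableSet_infinite_siteCluster (s : ℤˣ) (x : Site 2) :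
    MeasurableSet {ω : SpinConfig (Site 2) | (siteCluster (zdGraph 2) (spinSites s ω) x).Infinite} :=
  measurable_spinSites s (measurableSet_sitePercolatesAt (G := zdGraph 2) x)

/-- `boxConn` depends only on the spins in `Λ_N`, hence is measurable. [folklore] -/
theorem measurableSet_boxConn (s : ℤˣ) (N : ℕ) (x e : Site 2) :
    MeasurableSet {ω : SpinConfig (Site 2) | boxConn s N ω x e} := by
  refine cylinderEvents_le_pi _ (measurableSet_cylinderEvents_of_forall_eq (K := box 2 N) ?_)
  intro ω ω' h
  have hO : spinSites s ω ∩ ↑(box 2 N) = spinSites s ω' ∩ ↑(box 2 N) := by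
    ext z
    simp only [Set.mem_inter_iff, mem_spinSites, Finset.mem_coe]
    constructor
    · rintro ⟨hz, hzB⟩; exact ⟨by rw [← h z hzB]; exact hz, hzB⟩
    · rintro ⟨hz, hzB⟩; exact ⟨by rw [h z hzB]; exact hz, hzB⟩
  simp only [Set.mem_setOf_eq, boxConn, hO]

/-- Arm events are measurable. [folklore] -/
theorem measurableSet_quadArmEvent (s : ℤˣ) (m N : ℕ) (T : Set (Site 2)) :
    MeasurableSet (quadArmEvent s m N T) := by
  have h : quadArmEvent s m N T = ⋃ x ∈ box 2 m, ({ω | (siteCluster (zdGraph 2) (spinSites s ω) x).Infinite} ∩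
      ⋃ e ∈ T, {ω | boxConn s N ω x e}) := by
    ext ω; simp only [quadArmEvent, Set.mem_setOf_eq, Set.mem_iUnion, Set.mem_inter_iff, exists_prop]
  rw [h]
  exact MeasurableSet.biUnion (Set.to_countable _) fun x _ =>
    (measurableSet_infinite_siteCluster s x).inter
      (MeasurableSet.biUnion (Set.to_countable _) fun e _ => measurableSet_boxConn s N x e)

/-- Local uniqueness events are measurable. [folklore] -/
theorem measurableSet_localUnique (s : ℤˣ) (m N : ℕ) : MeasurableSet (localUnique s m N) := by
  have h : localUnique s m N = ⋂ x ∈ box 2 m, ⋂ y ∈ box 2 m,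
      ({ω | (siteCluster (zdGraph 2) (spinSites s ω) x).Infinite}ᶜ ∪
        ({ω | (siteCluster (zdGraph 2) (spinSites s ω) y).Infinite}ᶜ ∪ {ω | boxConn s N ω x y})) := by
    ext ω
    simp only [localUnique, Set.mem_setOf_eq, Set.mem_iInter, Set.mem_union, Set.mem_compl_iff]
    constructor
    · intro h x hx y hy
      by_cases h1 : (siteCluster (zdGraph 2) (spinSites s ω) x).Infinite
      · by_cases h2 : (siteCluster (zdGraph 2) (spinSites s ω) y).Infinite
        · exact Or.inr (Or.inr (h x hx y hy h1 h2))
        · exact Or.inr (Or.inl h2)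
      · exact Or.inl h1
    · intro h x hx y hy h1 h2
      rcases h x hx y hy with h' | h' | h'
      · exact absurd h1 h'
      · exact absurd h2 h'
      · exact h'
  rw [h]
  exact MeasurableSet.biInter (Set.to_countable _) fun x _ => MeasurableSet.biInter (Set.to_countable _)
    fun y _ => (measurableSet_infinite_siteCluster s x).compl.union
      ((measurableSet_infinite_siteCluster s y).compl.union (measurableSet_boxConn s N x y))

/-- The `+`arm events are increasing. [cite: GeorgiiHiguchi2000, Lemma 3.1 (proof, Step 2, p. 7)] -/
theorem isUpperSet_quadArmEvent_one (m N : ℕ) (T : Set (Site 2)) : IsUpperSet (quadArmEvent 1 m N T) := by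
  intro ω ω' hle hω
  obtain ⟨x, hx, hinf, e, he, hconn⟩ := hω
  have hsub : spinSites 1 ω ⊆ spinSites 1 ω' := spinSites_one_mono hle
  refine ⟨x, hx, hinf.mono (siteCluster_mono hsub x), e, he, ?_⟩
  exact hconn.mono (siteOpenGraph_mono _ (Set.inter_subset_inter_left _ hsub))

/-- `boxConn` is monotone in the box. [folklore] -/
theorem boxConn_mono {s : ℤˣ} {N N' : ℕ} (h : N ≤ N') {ω : SpinConfig (Site 2)} {x e : Site 2}
    (hc : boxConn s N ω x e) : boxConn s N' ω x e :=
  hc.mono (siteOpenGraph_mono _ (Set.inter_subset_inter_right _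
    (Finset.coe_subset.2 (box_mono 2 h))))

/-- The end of a box connection from an `s`-site of `Λ_N` is an `s`-site of `Λ_N`. [folklore] -/
theorem mem_of_boxConn {s : ℤˣ} {N : ℕ} {ω : SpinConfig (Site 2)} {x e : Site 2}
    (hc : boxConn s N ω x e) (hx : x ∈ spinSites s ω ∩ ↑(box 2 N)) : e ∈ spinSites s ω ∩ ↑(box 2 N) := by
  obtain ⟨p⟩ := hc
  exact support_subset_of_walk_siteOpenGraph p hx e (Walk.end_mem_support p)

/-- A site with an infinite `s`-cluster is an `s`-site. [folklore] -/
theorem mem_spinSites_of_infinite {s : ℤˣ} {ω : SpinConfig (Site 2)} {x : Site 2}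
    (h : (siteCluster (zdGraph 2) (spinSites s ω) x).Infinite) : x ∈ spinSites s ω := by
  obtain ⟨y, hy⟩ := h.nonempty
  exact hy.1

end Events

/-! ### Covering: an infinite cluster meeting `Λ_m` reaches some quadrant arc of `∂Λ_N` -/

section Cover

/-- A site of `Λ_N` with a neighbour outside `Λ_N` lies on one of the four quadrant arcs. [folklore] -/
theorem exists_quadArc_of_adj {N : ℕ} {a b : Site 2} (ha : a ∈ box 2 N) (hb : b ∉ box 2 N)
    (hab : (zdGraph 2).Adj a b) : ∃ q : ℤˣ × ℤˣ, a ∈ quadArc q N := by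
  rw [mem_box] at ha hb
  push Not at hb
  obtain ⟨i, hi⟩ := hb
  have ha0 := ha 0; have ha1 := ha 1
  have hk := stepKind_of_adj hab
  -- the sign of the other coordinate
  have hsgn : ∀ t : ℤ, ∃ u : ℤˣ, 0 ≤ (u : ℤ) * t := fun t => by
    rcases le_or_gt 0 t with ht | ht
    · exact ⟨1, by simpa using ht⟩
    · exact ⟨-1, by simp; omega⟩
  rcases hk with ⟨h0, h1⟩ | ⟨h0, h1⟩ | ⟨h1, h0⟩ | ⟨h1, h0⟩
  · -- step right: `a 0 = N`
    have : a 0 = N := by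
      fin_cases i <;> simp at hi <;> omega
    obtain ⟨u, hu⟩ := hsgn (a 1)
    exact ⟨(1, u), Or.inl ⟨by simpa using this, hu⟩⟩
  · -- step left: `a 0 = -N`
    have : a 0 = -N := by
      fin_cases i <;> simp at hi <;> omega
    obtain ⟨u, hu⟩ := hsgn (a 1)
    exact ⟨(-1, u), Or.inl ⟨by simp; omega, hu⟩⟩
  · -- step up: `a 1 = N`
    have : a 1 = N := by
      fin_cases i <;> simp at hi <;> omega
    obtain ⟨u, hu⟩ := hsgn (a 0)
    exact ⟨(u, 1), Or.inr ⟨by simpa using this, hu⟩⟩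
  · -- step down: `a 1 = -N`
    have : a 1 = -N := by
      fin_cases i <;> simp at hi <;> omega
    obtain ⟨u, hu⟩ := hsgn (a 0)
    exact ⟨(u, -1), Or.inr ⟨by simp; omega, hu⟩⟩

/-- **Covering** ("`{Λ ∩ I⁺ ≠ ∅} ⊂ ⋃_k A⁺_k`", Georgii–Higuchi 2000, p. 7): if some site of `Λ_m`
has an infinite `s`-cluster then, for `N ≥ m`, some arm event `A^s(∂_qΛ_N)` occurs — follow an
`s`-path from the site until it first leaves `Λ_N`. [cite: GeorgiiHiguchi2000, Lemma 3.1 (proof, Step 2, p. 7)] -/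
theorem subset_iUnion_quadArmEvent (s : ℤˣ) {m N : ℕ} (hmN : m ≤ N) :
    {ω : SpinConfig (Site 2) | ∃ x ∈ box 2 m, (siteCluster (zdGraph 2) (spinSites s ω) x).Infinite} ⊆
      ⋃ q : ℤˣ × ℤˣ, quadArmEvent s m N (quadArc q N) := by
  rintro ω ⟨x, hx, hinf⟩
  have hxN : x ∈ box 2 N := box_mono 2 hmN hx
  -- an `s`-path from `x` leaving `Λ_N`
  obtain ⟨y, hy, hyN⟩ : ∃ y ∈ siteCluster (zdGraph 2) (spinSites s ω) x, y ∉ box 2 N := by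
    by_contra h
    push Not at h
    exact hinf ((box 2 N).finite_toSet.subset fun y hy => h y hy)
  obtain ⟨-, -, hr⟩ := hy
  obtain ⟨p⟩ := hr
  obtain ⟨a, b, ha, hb, hab, -, hreach⟩ := exists_adj_reachable_withinGraph_of_walk
    (siteOpenGraph (zdGraph 2) (spinSites s ω)) p (S := (↑(box 2 N) : Set (Site 2))) hxN
    ⟨y, Walk.end_mem_support p, hyN⟩
  have hab' := (siteOpenGraph_adj _ _ _ _).1 hab
  obtain ⟨q, hq⟩ := exists_quadArc_of_adj ha hb hab'.1
  refine Set.mem_iUnion.2 ⟨q, x, hx, hinf, a, hq, ?_⟩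
  change (siteOpenGraph (zdGraph 2) (spinSites s ω ∩ ↑(box 2 N))).Reachable x a
  rwa [withinGraph_siteOpenGraph] at hreach

end Cover

/-! ### Transport of arm events under flip-reflections -/

section Transport

/-- `S^s(-σ) = S^{-s}(σ)`. [folklore] -/
theorem spinSites_neg_config {V : Type*} (s : ℤˣ) (σ : SpinConfig V) :
    spinSites s (-σ) = spinSites (-s) σ := by
  ext x; simp only [mem_spinSites, Pi.neg_apply]; exact neg_eq_iff_eq_neg

/-- Membership in a centred box is invariant under a coordinate reflection. [cite: GeorgiiHiguchi2000, §2 p. 3] -/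
theorem reflectCoord_mem_box_iff (i : Fin 2) (n : ℕ) (z : Site 2) :
    reflectCoord i z ∈ box 2 n ↔ z ∈ box 2 n := by
  simp only [mem_box, reflectCoord_apply]
  constructor
  · intro h j
    have := h j
    by_cases hj : j = i
    · simp [hj] at this ⊢
      subst hj
      omega
    · simpa [hj] using this
  · intro h j
    have := h j
    by_cases hj : j = i
    · simp [hj] at this ⊢
      subst hj
      omega
    · simpa [hj] using this

/-- **Flip-reflections transport arm events**: `(R∘T)⁻¹(A^s(T)) ⊆ A^{-s}(R(T))` for a coordinate
reflection `R` (Georgii–Higuchi 2000, p. 8: "By the flip-reflection symmetry shown above"). [cite: GeorgiiHiguchi2000, Lemma 3.1 (proof, Step 2, p. 8)] -/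
theorem preimage_flipRelabel_quadArmEvent_subset (i : Fin 2) (s : ℤˣ) (m N : ℕ) (T : Set (Site 2)) :
    flipRelabel (reflectCoord i).toEquiv ⁻¹' quadArmEvent s m N T ⊆ quadArmEvent (-s) m N (reflectCoord i '' T) := by
  intro ω hω
  set R := reflectCoord (d := 2) i with hR
  have hRR : ∀ z, R (R z) = z := reflectCoord_reflectCoord i
  -- the `s`-sites of `R∘T(ω)` are the reflected `-s`-sites of `ω`
  have hS : spinSites s (flipRelabel R.toEquiv ω) = R.toEquiv '' spinSites (-s) ω := by
    rw [flipRelabel_eq_neg_comp, Function.comp_apply, spinSites_neg_config, spinSites_configRelabel]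
  obtain ⟨x, hx, hinf, e, he, hconn⟩ := hω
  rw [hS] at hinf
  have hconn' : (siteOpenGraph (zdGraph 2) (R.toEquiv '' spinSites (-s) ω ∩ ↑(box 2 N))).Reachable x e := by
    unfold boxConn at hconn; rwa [hS] at hconn
  refine ⟨R x, (reflectCoord_mem_box_iff i m x).2 hx, ?_, R e, Set.mem_image_of_mem _ he, ?_⟩
  · -- the cluster of `x = R (R x)` in `R(S^{-s})` is the image of the cluster of `R x`
    have key := siteCluster_relabel R (spinSites (-s) ω) (R x)
    rw [Literature.Probability.Percolation.SiteConfig.relabel_apply, hRR] at key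
    rw [key] at hinf
    exact Set.Infinite.of_image _ hinf
  · -- transport the connecting path by `R`
    have himg : R.toEquiv '' spinSites (-s) ω ∩ ↑(box 2 N) =
        R.toEquiv '' (spinSites (-s) ω ∩ ↑(box 2 N)) := by
      ext z
      simp only [Set.mem_inter_iff, Set.mem_image, Finset.mem_coe]
      constructor
      · rintro ⟨⟨w, hw, rfl⟩, hzB⟩
        exact ⟨w, ⟨hw, (reflectCoord_mem_box_iff i N w).1 hzB⟩, rfl⟩
      · rintro ⟨w, ⟨hw, hwB⟩, rfl⟩
        exact ⟨⟨w, hw, rfl⟩, (reflectCoord_mem_box_iff i N w).2 hwB⟩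
    rw [himg] at hconn'
    set O := spinSites (-s) ω ∩ ↑(box 2 N) with hO
    -- `R` is a homomorphism from the subgraph on `R(O)` to the subgraph on `O`
    let φ : siteOpenGraph (zdGraph 2) (R.toEquiv '' O) →g siteOpenGraph (zdGraph 2) O :=
      { toFun := R
        map_rel' := fun {a b} hab => by
          rw [siteOpenGraph_adj] at hab ⊢
          obtain ⟨hG, ⟨a', ha', haa⟩, ⟨b', hb', hbb⟩⟩ := hab
          refine ⟨R.map_rel_iff.2 hG, ?_, ?_⟩
          · change R.toEquiv a' = a at haa
            rw [← haa]; change R (R a') ∈ O; rwa [hRR]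
          · change R.toEquiv b' = b at hbb
            rw [← hbb]; change R (R b') ∈ O; rwa [hRR] }
    exact hconn'.map φ

/-- Reflection in the `x₁`-axis (`x₀ ↦ -x₀`) maps `∂_{(q₁,q₂)}` into `∂_{(-q₁,q₂)}`. [folklore] -/
theorem image_reflectCoord_zero_quadArc_subset (q : ℤˣ × ℤˣ) (N : ℕ) :
    reflectCoord 0 '' quadArc q N ⊆ quadArc (-q.1, q.2) N := by
  rintro _ ⟨e, he, rfl⟩
  simp only [quadArc, Set.mem_setOf_eq, reflectCoord_apply, Units.val_neg] at he ⊢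
  simp
  rcases he with ⟨h1, h2⟩ | ⟨h1, h2⟩
  · left; constructor <;> linarith
  · right; constructor <;> linarith

/-- Reflection in the `x₀`-axis (`x₁ ↦ -x₁`) maps `∂_{(q₁,q₂)}` into `∂_{(q₁,-q₂)}`. [folklore] -/
theorem image_reflectCoord_one_quadArc_subset (q : ℤˣ × ℤˣ) (N : ℕ) :
    reflectCoord 1 '' quadArc q N ⊆ quadArc (q.1, -q.2) N := by
  rintro _ ⟨e, he, rfl⟩
  simp only [quadArc, Set.mem_setOf_eq, reflectCoord_apply, Units.val_neg] at he ⊢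
  simp
  rcases he with ⟨h1, h2⟩ | ⟨h1, h2⟩
  · left; constructor <;> linarith
  · right; constructor <;> linarith

/-- Arm events are monotone in the target set. [folklore] -/
theorem quadArmEvent_mono {s : ℤˣ} {m N : ℕ} {T T' : Set (Site 2)} (h : T ⊆ T') :
    quadArmEvent s m N T ⊆ quadArmEvent s m N T' := fun _ ⟨x, hx, hinf, e, he, hc⟩ =>
  ⟨x, hx, hinf, e, h he, hc⟩

end Transport

/-! ### Positive correlations for decreasing events -/

section FKG

variable {d : ℕ} {β h : ℝ} {μ : Measure (SpinConfig (Site d))}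

/-- **FKG for two decreasing events** under a tail-trivial `μ ∈ 𝒢(β, h)`, `β ≥ 0`
(Georgii–Higuchi 2000, §2 p. 3: extremal Gibbs measures have positive correlations; here from
`isingGibbs_integral_mul_ge_of_isTailTrivial` applied to `-1_D`, `-1_E`). [cite: GeorgiiHiguchi2000, §2 p. 3] -/
theorem measureReal_inter_ge_mul_of_isLowerSet (hβ : 0 ≤ β) (hμ : μ ∈ isingGibbsMeasures d β h)
    (hμt : IsTailTrivial μ) {D E : Set (SpinConfig (Site d))} (hD : IsLowerSet D) (hE : IsLowerSet E)
    (hDm : MeasurableSet D) (hEm : MeasurableSet E) :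
    μ.real D * μ.real E ≤ μ.real (D ∩ E) := by
  have hμG : IsGibbsMeasure (isingSpecification (zdGraph d) β h) μ := hμ
  haveI := hμG.isProbabilityMeasure
  set f : SpinConfig (Site d) → ℝ := fun σ => -(D.indicator 1 σ) with hf
  set g : SpinConfig (Site d) → ℝ := fun σ => -(E.indicator 1 σ) with hg
  have hmono : ∀ {A : Set (SpinConfig (Site d))}, IsLowerSet A →
      Monotone fun σ : SpinConfig (Site d) => -(A.indicator (1 : SpinConfig (Site d) → ℝ) σ) := by
    intro A hA σ τ hστ
    simp only [neg_le_neg_iff]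
    by_cases hτ : τ ∈ A
    · rw [Set.indicator_of_mem hτ, Set.indicator_of_mem (hA hστ hτ)]
      exact le_rfl
    · rw [Set.indicator_of_notMem hτ]
      by_cases hσ : σ ∈ A
      · rw [Set.indicator_of_mem hσ]; simp
      · rw [Set.indicator_of_notMem hσ]
  have hbd : ∀ {A : Set (SpinConfig (Site d))} (σ : SpinConfig (Site d)),
      |(-(A.indicator (1 : SpinConfig (Site d) → ℝ) σ))| ≤ 1 := by
    intro A σ
    rw [abs_neg]
    by_cases hσ : σ ∈ A
    · rw [Set.indicator_of_mem hσ]; simp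
    · rw [Set.indicator_of_notMem hσ]; simp
  have key := isingGibbs_integral_mul_ge_of_isTailTrivial hβ hμ hμt (hmono hD) (hmono hE)
    ((measurable_const.indicator hDm).neg) ((measurable_const.indicator hEm).neg) hbd hbd
  have h1 : ∫ σ, -(D.indicator (1 : SpinConfig (Site d) → ℝ) σ) ∂μ = -μ.real D := by
    rw [integral_neg, integral_indicator_one hDm]
  have h2 : ∫ σ, -(E.indicator (1 : SpinConfig (Site d) → ℝ) σ) ∂μ = -μ.real E := by
    rw [integral_neg, integral_indicator_one hEm]
  have h3 : ∫ σ, -(D.indicator (1 : SpinConfig (Site d) → ℝ) σ) * -(E.indicator 1 σ) ∂μ =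
      μ.real (D ∩ E) := by
    simp only [neg_mul_neg]
    rw [← integral_indicator_one (hDm.inter hEm)]
    refine integral_congr_ae (Eventually.of_forall fun σ => ?_)
    rw [Set.inter_indicator_one]
    rfl
  rw [h1, h2, h3, neg_mul_neg] at key
  exact key

/-- **FKG for finitely many decreasing events**: `∏ μ(D_i) ≤ μ(⋂ D_i)` (Georgii–Higuchi 2000, p. 7:
"`∏_k μ(Ω ∖ A⁺_k) ≤ μ(⋂_k Ω ∖ A⁺_k)`"). [cite: GeorgiiHiguchi2000, Lemma 3.1 (proof, Step 2, p. 7)] -/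
theorem prod_measureReal_le_measureReal_iInter_of_isLowerSet {ι : Type*} (hβ : 0 ≤ β)
    (hμ : μ ∈ isingGibbsMeasures d β h) (hμt : IsTailTrivial μ) (t : Finset ι)
    {D : ι → Set (SpinConfig (Site d))} (hD : ∀ i, IsLowerSet (D i)) (hDm : ∀ i, MeasurableSet (D i)) :
    ∏ i ∈ t, μ.real (D i) ≤ μ.real (⋂ i ∈ t, D i) := by
  classical
  have hμG : IsGibbsMeasure (isingSpecification (zdGraph d) β h) μ := hμ
  haveI := hμG.isProbabilityMeasure
  induction t using Finset.induction_on with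
  | empty => simp
  | insert a t hat ih =>
    rw [Finset.prod_insert hat]
    have hset : (⋂ i ∈ insert a t, D i) = D a ∩ ⋂ i ∈ t, D i := by
      ext ω; simp
    rw [hset]
    have hlow : IsLowerSet (⋂ i ∈ t, D i) := isLowerSet_iInter₂ fun i _ => hD i
    have hmeas : MeasurableSet (⋂ i ∈ t, D i) :=
      Finset.measurableSet_biInter t fun i _ => hDm i
    calc μ.real (D a) * ∏ i ∈ t, μ.real (D i) ≤ μ.real (D a) * μ.real (⋂ i ∈ t, D i) :=
          mul_le_mul_of_nonneg_left ih measureReal_nonneg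
      _ ≤ μ.real (D a ∩ ⋂ i ∈ t, D i) :=
          measureReal_inter_ge_mul_of_isLowerSet hβ hμ hμt (hD a) hlow (hDm a) hmeas

end FKG

/-! ### The deterministic endgame -/

section Endgame

/-- Coordinates of the four quadrant arcs in the form of `ZhangCrossing`. [folklore] -/
theorem quadArc_one_one {N : ℕ} {e : Site 2} (he : e ∈ quadArc (1, 1) N) :
    (e 0 = N ∧ 0 ≤ e 1) ∨ (e 1 = N ∧ 0 ≤ e 0) := by
  simp only [quadArc, Set.mem_setOf_eq, Units.val_one, one_mul] at he; exact he

/-- Coordinates of the four quadrant arcs in the form of `ZhangCrossing`. [folklore] -/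
theorem quadArc_neg_one {N : ℕ} {e : Site 2} (he : e ∈ quadArc (-1, 1) N) :
    (e 1 = N ∧ e 0 ≤ 0) ∨ (e 0 = -N ∧ 0 ≤ e 1) := by
  simp only [quadArc, Set.mem_setOf_eq, Units.val_one, one_mul, Units.val_neg] at he
  rcases he with ⟨h1, h2⟩ | ⟨h1, h2⟩
  · right; constructor <;> linarith
  · left; constructor <;> linarith

/-- Coordinates of the four quadrant arcs in the form of `ZhangCrossing`. [folklore] -/
theorem quadArc_neg_neg {N : ℕ} {e : Site 2} (he : e ∈ quadArc (-1, -1) N) :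
    (e 0 = -N ∧ e 1 ≤ 0) ∨ (e 1 = -N ∧ e 0 ≤ 0) := by
  simp only [quadArc, Set.mem_setOf_eq, Units.val_neg, Units.val_one] at he
  rcases he with ⟨h1, h2⟩ | ⟨h1, h2⟩
  · left; constructor <;> linarith
  · right; constructor <;> linarith

/-- Coordinates of the four quadrant arcs in the form of `ZhangCrossing`. [folklore] -/
theorem quadArc_one_neg {N : ℕ} {e : Site 2} (he : e ∈ quadArc (1, -1) N) :
    (e 1 = -N ∧ 0 ≤ e 0) ∨ (e 0 = N ∧ e 1 ≤ 0) := by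
  simp only [quadArc, Set.mem_setOf_eq, Units.val_neg, Units.val_one, one_mul] at he
  rcases he with ⟨h1, h2⟩ | ⟨h1, h2⟩
  · right; constructor <;> linarith
  · left; constructor <;> linarith

/-- **Zhang's contradiction** (Georgii–Higuchi 2000, p. 8: on `A⁺₁ ∩ A⁻₂ ∩ A⁺₃ ∩ A⁻₄` "the infinite
clusters `I⁺` and `I⁻` cannot be both unique"): a `+`path inside `Λ_N` between the arcs of two
opposite quadrants and a `-`path inside `Λ_N` between the arcs of the other two quadrants cannot
coexist, by `exists_mem_support_of_quadrant_crossing`. [cite: GeorgiiHiguchi2000, Lemma 3.1 (proof, Step 2, p. 8)] -/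
theorem false_of_crossing_arms {N : ℕ} {ω : SpinConfig (Site 2)} (q : ℤˣ × ℤˣ) {e₁ e₂ e₃ e₄ : Site 2}
    (he₁ : e₁ ∈ quadArc q N) (he₃ : e₃ ∈ quadArc (-q.1, -q.2) N)
    (he₂ : e₂ ∈ quadArc (-q.1, q.2) N) (he₄ : e₄ ∈ quadArc (q.1, -q.2) N)
    (P : (zdGraph 2).Walk e₁ e₃) (Q : (zdGraph 2).Walk e₂ e₄)
    (hP : ∀ z ∈ P.support, z ∈ spinSites 1 ω ∩ ↑(box 2 N))
    (hQ : ∀ z ∈ Q.support, z ∈ spinSites (-1) ω ∩ ↑(box 2 N)) : False := by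
  have hPb : ∀ z ∈ P.support, ∀ i, -(N : ℤ) ≤ z i ∧ z i ≤ N := fun z hz =>
    mem_box.1 (Finset.mem_coe.1 (hP z hz).2)
  have hQb : ∀ z ∈ Q.support, ∀ i, -(N : ℤ) ≤ z i ∧ z i ≤ N := fun z hz =>
    mem_box.1 (Finset.mem_coe.1 (hQ z hz).2)
  have hPb' : ∀ z ∈ P.reverse.support, ∀ i, -(N : ℤ) ≤ z i ∧ z i ≤ N := fun z hz =>
    hPb z (by rwa [Walk.support_reverse, List.mem_reverse] at hz)
  have hQb' : ∀ z ∈ Q.reverse.support, ∀ i, -(N : ℤ) ≤ z i ∧ z i ≤ N := fun z hz =>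
    hQb z (by rwa [Walk.support_reverse, List.mem_reverse] at hz)
  -- a common vertex, in each of the four positions of `q`
  have common : ∃ z ∈ P.support, z ∈ Q.support := by
    obtain ⟨q₁, q₂⟩ := q
    rcases Int.units_eq_one_or q₁ with rfl | rfl <;> rcases Int.units_eq_one_or q₂ with rfl | rfl
    · -- `q = (1, 1)`: `P : ∂₁ → ∂₃`, `Q : ∂₂ → ∂₄`
      exact exists_mem_support_of_quadrant_crossing P Q hPb hQb (quadArc_one_one he₁)
        (quadArc_neg_one he₂) (quadArc_neg_neg he₃) (quadArc_one_neg he₄)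
    · -- `q = (1, -1)`: `P : ∂₄ → ∂₂`, `Q : ∂₃ → ∂₁`; use `Q⁻¹ : ∂₁ → ∂₃` and `P⁻¹ : ∂₂ → ∂₄`
      simp only [neg_neg] at he₃ he₂ he₄
      obtain ⟨z, hzQ, hzP⟩ := exists_mem_support_of_quadrant_crossing Q.reverse P.reverse hQb' hPb'
        (quadArc_one_one he₄) (quadArc_neg_one he₃) (quadArc_neg_neg he₂) (quadArc_one_neg he₁)
      rw [Walk.support_reverse, List.mem_reverse] at hzQ hzP
      exact ⟨z, hzP, hzQ⟩
    · -- `q = (-1, 1)`: `P : ∂₂ → ∂₄`, `Q : ∂₁ → ∂₃`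
      simp only [neg_neg] at he₃ he₂ he₄
      obtain ⟨z, hzQ, hzP⟩ := exists_mem_support_of_quadrant_crossing Q P hQb hPb
        (quadArc_one_one he₂) (quadArc_neg_one he₁) (quadArc_neg_neg he₄) (quadArc_one_neg he₃)
      exact ⟨z, hzP, hzQ⟩
    · -- `q = (-1, -1)`: `P : ∂₃ → ∂₁`, `Q : ∂₄ → ∂₂`; reverse both
      simp only [neg_neg] at he₃ he₂ he₄
      obtain ⟨z, hzP, hzQ⟩ := exists_mem_support_of_quadrant_crossing P.reverse Q.reverse hPb' hQb'
        (quadArc_one_one he₃) (quadArc_neg_one he₄) (quadArc_neg_neg he₁) (quadArc_one_neg he₂)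
      rw [Walk.support_reverse, List.mem_reverse] at hzQ hzP
      exact ⟨z, hzP, hzQ⟩
  obtain ⟨z, hzP, hzQ⟩ := common
  have h1 : ω z = 1 := (hP z hzP).1
  have h2 : ω z = -1 := (hQ z hzQ).1
  rw [h1] at h2
  exact absurd h2 (by decide)

end Endgame

/-! ### Assembly -/

section Assembly

variable {β : ℝ} {μ : Measure (SpinConfig (Site 2))}

/-- From `E^s` almost surely: some `Λ_m` meets an infinite `s`-cluster with probability `> 1 - ε`. [cite: GeorgiiHiguchi2000, Lemma 3.1 (proof, Step 2, p. 7)] -/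
theorem exists_box_meets_infinite (s : ℤˣ) [IsProbabilityMeasure μ]
    (hE : μ (existsInfCluster (zdGraph 2) s) = 1) {ε : ℝ} (hε : 0 < ε) :
    ∀ᶠ m : ℕ in atTop, 1 - ε < μ.real {ω : SpinConfig (Site 2) |
      ∃ x ∈ box 2 m, (siteCluster (zdGraph 2) (spinSites s ω) x).Infinite} := by
  set F : ℕ → Set (SpinConfig (Site 2)) := fun m =>
    {ω | ∃ x ∈ box 2 m, (siteCluster (zdGraph 2) (spinSites s ω) x).Infinite} with hF
  have hmono : Monotone F := fun m n hmn ω ⟨x, hx, h⟩ => ⟨x, box_mono 2 hmn hx, h⟩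
  have hU : (⋃ m, F m) = existsInfCluster (zdGraph 2) s := by
    ext ω
    simp only [Set.mem_iUnion, hF, Set.mem_setOf_eq, mem_existsInfCluster_iff]
    constructor
    · rintro ⟨m, x, -, hx⟩; exact ⟨x, hx⟩
    · rintro ⟨x, hx⟩
      obtain ⟨m, hm⟩ := (eventually_subset_box_holds (d := 2) {x}).exists
      exact ⟨m, x, hm (Finset.mem_singleton_self x), hx⟩
  have ht := tendsto_measure_iUnion_atTop (μ := μ) hmono
  rw [hU, hE] at ht
  have ht' : Tendsto (fun m => μ.real (F m)) atTop (𝓝 1) := by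
    have := (ENNReal.tendsto_toReal ENNReal.one_ne_top).comp ht
    simpa [measureReal_def, Function.comp_def] using this
  exact (tendsto_order.1 ht').1 _ (by linarith)

/-- From a.s. uniqueness of the infinite `s`-cluster: local uniqueness in `Λ_N` with probability
`> 1 - ε` for `N` large. [cite: GeorgiiHiguchi2000, Lemma 3.1 (proof, Step 2, p. 7)] -/
theorem eventually_measureReal_localUnique (s : ℤˣ) [IsProbabilityMeasure μ] (m : ℕ)
    (huniq : ∀ᵐ ω ∂μ, ∀ x y, (siteCluster (zdGraph 2) (spinSites s ω) x).Infinite →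
      (siteCluster (zdGraph 2) (spinSites s ω) y).Infinite →
        (siteOpenGraph (zdGraph 2) (spinSites s ω)).Reachable x y) {ε : ℝ} (hε : 0 < ε) :
    ∀ᶠ N : ℕ in atTop, 1 - ε < μ.real (localUnique s m N) := by
  have hmono : Monotone (localUnique s m) := fun N N' hNN' ω hω x hx y hy h1 h2 =>
    boxConn_mono hNN' (hω x hx y hy h1 h2)
  -- the union over `N` contains the a.s. event of uniqueness
  have hcov : {ω | ∀ x y, (siteCluster (zdGraph 2) (spinSites s ω) x).Infinite →
      (siteCluster (zdGraph 2) (spinSites s ω) y).Infinite →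
        (siteOpenGraph (zdGraph 2) (spinSites s ω)).Reachable x y} ⊆ ⋃ N, localUnique s m N := by
    intro ω hω
    have hev : ∀ x ∈ box 2 m, ∀ y ∈ box 2 m, ∀ᶠ N : ℕ in atTop,
        (siteCluster (zdGraph 2) (spinSites s ω) x).Infinite →
          (siteCluster (zdGraph 2) (spinSites s ω) y).Infinite → boxConn s N ω x y := by
      intro x _ y _
      by_cases h1 : (siteCluster (zdGraph 2) (spinSites s ω) x).Infinite
      · by_cases h2 : (siteCluster (zdGraph 2) (spinSites s ω) y).Infinite
        · obtain ⟨p⟩ := hω x y h1 h2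
          have hx : x ∈ spinSites s ω := mem_spinSites_of_infinite h1
          obtain ⟨N₀, hN₀⟩ := (eventually_subset_box_holds (d := 2) p.support.toFinset).exists_forall_of_atTop
          refine eventually_atTop.2 ⟨N₀, fun N hN _ _ => ?_⟩
          have hsupp : ∀ z ∈ p.support, z ∈ spinSites s ω ∩ ↑(box 2 N) := fun z hz =>
            ⟨support_subset_of_walk_siteOpenGraph p hx z hz,
              Finset.mem_coe.2 (hN₀ N hN (List.mem_toFinset.2 hz))⟩
          exact siteOpenGraph_reachable_of_walk (p.mapLe (by
            intro a b hab; exact ((siteOpenGraph_adj _ _ _ _).1 hab).1)) (by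
            intro z hz; rw [Walk.support_mapLe_eq_support] at hz; exact hsupp z hz)
        · exact Eventually.of_forall fun N _ h => absurd h h2
      · exact Eventually.of_forall fun N h _ => absurd h h1
    have hev' : ∀ᶠ N : ℕ in atTop, ∀ x ∈ box 2 m, ∀ y ∈ box 2 m,
        (siteCluster (zdGraph 2) (spinSites s ω) x).Infinite →
          (siteCluster (zdGraph 2) (spinSites s ω) y).Infinite → boxConn s N ω x y := by
      rw [eventually_all_finset]
      intro x hx
      rw [eventually_all_finset]
      exact hev x hx
    obtain ⟨N, hN⟩ := hev'.exists
    exact Set.mem_iUnion.2 ⟨N, hN⟩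
  have h0 : μ (⋃ N, localUnique s m N)ᶜ = 0 := by
    have hsub : (⋃ N, localUnique s m N)ᶜ ⊆ {ω | ¬ ∀ x y,
        (siteCluster (zdGraph 2) (spinSites s ω) x).Infinite →
          (siteCluster (zdGraph 2) (spinSites s ω) y).Infinite →
            (siteOpenGraph (zdGraph 2) (spinSites s ω)).Reachable x y} :=
      fun ω hω hω' => hω (hcov hω')
    exact measure_mono_null hsub (ae_iff.1 huniq)
  have h1 : μ (⋃ N, localUnique s m N) = 1 :=
    (prob_compl_eq_zero_iff (MeasurableSet.iUnion fun N => measurableSet_localUnique s m N)).1 h0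
  have ht := tendsto_measure_iUnion_atTop (μ := μ) hmono
  rw [h1] at ht
  have ht' : Tendsto (fun N => μ.real (localUnique s m N)) atTop (𝓝 1) := by
    have := (ENNReal.tendsto_toReal ENNReal.one_ne_top).comp ht
    simpa [measureReal_def, Function.comp_def] using this
  exact (tendsto_order.1 ht').1 _ (by linarith)

/-- **The butterfly lemma for coexisting tail-trivial states** (Georgii–Higuchi 2000, Lemma 3.1,
for the case used in §§4–5): for `β ≥ 0` and a tail-trivial `μ ∈ 𝒢(β, 0)` on `ℤ²` under which both
an infinite `+`cluster and an infinite `-`cluster exist almost surely, there are `i ∈ {0, 1}`,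
`k ∈ {0, 1}` and a sign `s` such that with positive (hence full) probability both half-planes
`{x_i ≥ k}` and `{x_i ≤ k}` contain an infinite `s`-cluster. Proof: Steps 1 and 2 of the printed
proof (module docstring). [cite: GeorgiiHiguchi2000, Lemma 3.1] -/
theorem exists_infinite_butterfly (hβ : 0 ≤ β) (hμ : μ ∈ isingGibbsMeasures 2 β 0)
    (hμt : IsTailTrivial μ) (hcoex : ∀ s : ℤˣ, μ (existsInfCluster (zdGraph 2) s) = 1) :
    ∃ (i : Fin 2) (k : ℤ), (k = 0 ∨ k = 1) ∧ ∃ s : ℤˣ,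
      μ (existsInfClusterIn (zdGraph 2) s {x : Site 2 | k ≤ x i} ∩
        existsInfClusterIn (zdGraph 2) s {x : Site 2 | x i ≤ k}) ≠ 0 := by
  have hμG : IsGibbsMeasure (isingSpecification (zdGraph 2) β 0) μ := hμ
  haveI := hμG.isProbabilityMeasure
  by_contra hno
  push Not at hno
  -- Step 1: reflection invariance and periodicity; uniqueness of the infinite clusters
  have hinv := map_configRelabel_two_smul_eq_of_no_butterflies hβ hμ hμt hno
  have huniq : ∀ s : ℤˣ, ∀ᵐ ω ∂μ, ∀ x y, (siteCluster (zdGraph 2) (spinSites s ω) x).Infinite →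
      (siteCluster (zdGraph 2) (spinSites s ω) y).Infinite →
        (siteOpenGraph (zdGraph 2) (spinSites s ω)).Reachable x y := fun s =>
    IsGibbsMeasure.ae_siteCluster_unique_of_shift_invariant hμ hμt hinv s
  have hRT : ∀ i : Fin 2, μ.map (flipRelabel (reflectCoord i).toEquiv) = μ := fun i =>
    map_flipRelabel_eq_of_no_butterfly hβ hμ hμt i (hno i 0 (Or.inl rfl) (-1)) (hno i 0 (Or.inl rfl) 1)
  -- Step 2: the squares `Λ_m ⊆ Λ_N`
  obtain ⟨m, hm⟩ := (exists_box_meets_infinite 1 (hcoex 1) (by norm_num : (0 : ℝ) < (2 : ℝ)⁻¹ ^ 12)).exists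
  obtain ⟨N, hNm, hNp, hNn⟩ := ((eventually_ge_atTop m).and
    ((eventually_measureReal_localUnique 1 m (huniq 1) (by norm_num : (0 : ℝ) < 1 / 8)).and
      (eventually_measureReal_localUnique (-1) m (huniq (-1)) (by norm_num : (0 : ℝ) < 1 / 8)))).exists
  -- the arm events and their complements
  set A : ℤˣ → ℤˣ × ℤˣ → Set (SpinConfig (Site 2)) := fun s q => quadArmEvent s m N (quadArc q N) with hA
  have hAm : ∀ s q, MeasurableSet (A s q) := fun s q => measurableSet_quadArmEvent s m N _
  -- square-root trick: some `+`arm event has probability `> 7/8`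
  obtain ⟨q, hq⟩ : ∃ q : ℤˣ × ℤˣ, μ.real (A 1 q)ᶜ < 1 / 8 := by
    by_contra hall
    push Not at hall
    have hprod : ∏ q : ℤˣ × ℤˣ, μ.real (A 1 q)ᶜ ≤ μ.real (⋂ q ∈ (Finset.univ : Finset (ℤˣ × ℤˣ)), (A 1 q)ᶜ) :=
      prod_measureReal_le_measureReal_iInter_of_isLowerSet hβ hμ hμt Finset.univ
        (fun q => (isUpperSet_quadArmEvent_one m N (quadArc q N)).compl) fun q => (hAm 1 q).compl
    have hcov : (⋂ q ∈ (Finset.univ : Finset (ℤˣ × ℤˣ)), (A 1 q)ᶜ) ⊆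
        {ω | ∃ x ∈ box 2 m, (siteCluster (zdGraph 2) (spinSites 1 ω) x).Infinite}ᶜ := by
      intro ω hω hω'
      obtain ⟨q, hq⟩ := Set.mem_iUnion.1 (subset_iUnion_quadArmEvent 1 hNm hω')
      simp only [Set.mem_iInter, Finset.mem_univ, true_implies, Set.mem_compl_iff] at hω
      exact hω q hq
    have hsmall : μ.real {ω | ∃ x ∈ box 2 m, (siteCluster (zdGraph 2) (spinSites 1 ω) x).Infinite}ᶜ <
        (2 : ℝ)⁻¹ ^ 12 := by
      have hmeas : MeasurableSet {ω : SpinConfig (Site 2) | ∃ x ∈ box 2 m,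
          (siteCluster (zdGraph 2) (spinSites 1 ω) x).Infinite} := by
        have : {ω : SpinConfig (Site 2) | ∃ x ∈ box 2 m, (siteCluster (zdGraph 2) (spinSites 1 ω) x).Infinite} =
            ⋃ x ∈ box 2 m, {ω | (siteCluster (zdGraph 2) (spinSites 1 ω) x).Infinite} := by
          ext ω; simp
        rw [this]
        exact Finset.measurableSet_biUnion _ fun x _ => measurableSet_infinite_siteCluster 1 x
      rw [measureReal_compl hmeas, probReal_univ]
      linarith
    have hge : ((1 : ℝ) / 8) ^ 4 ≤ ∏ q : ℤˣ × ℤˣ, μ.real (A 1 q)ᶜ := by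
      have hcard : (Finset.univ : Finset (ℤˣ × ℤˣ)).card = 4 := by
        rw [Finset.card_univ, Fintype.card_prod, Fintype.card_units_int]
      calc ((1 : ℝ) / 8) ^ 4 = ∏ _q : ℤˣ × ℤˣ, ((1 : ℝ) / 8) := by
            rw [Finset.prod_const, hcard]
        _ ≤ ∏ q : ℤˣ × ℤˣ, μ.real (A 1 q)ᶜ :=
            Finset.prod_le_prod (fun q _ => by norm_num) fun q _ => hall q
    have := (hge.trans hprod).trans (measureReal_mono hcov)
    linarith [this, hsmall, show ((1 : ℝ) / 8) ^ 4 = (2 : ℝ)⁻¹ ^ 12 by norm_num]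
  -- flip-reflection symmetry: the three partner events
  have hsymm : ∀ (i : Fin 2) (s : ℤˣ) (q : ℤˣ × ℤˣ),
      μ.real (A s q) ≤ μ.real (quadArmEvent (-s) m N (reflectCoord i '' quadArc q N)) := by
    intro i s q
    have h1 : μ (A s q) = μ (flipRelabel (reflectCoord i).toEquiv ⁻¹' A s q) := by
      conv_lhs => rw [← hRT i]
      rw [Measure.map_apply (measurable_flipRelabel _) (hAm s q)]
    simp only [measureReal_def]
    rw [h1]
    exact ENNReal.toReal_mono (measure_ne_top _ _)
      (measure_mono (preimage_flipRelabel_quadArmEvent_subset i s m N _))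
  have hv : ∀ s q', μ.real (A s q') ≤ μ.real (A (-s) (-q'.1, q'.2)) := fun s q' =>
    (hsymm 0 s q').trans (measureReal_mono (quadArmEvent_mono (image_reflectCoord_zero_quadArc_subset q' N)))
  have hh : ∀ s q', μ.real (A s q') ≤ μ.real (A (-s) (q'.1, -q'.2)) := fun s q' =>
    (hsymm 1 s q').trans (measureReal_mono (quadArmEvent_mono (image_reflectCoord_one_quadArc_subset q' N)))
  have hc : ∀ s q', μ.real (A s q')ᶜ = 1 - μ.real (A s q') := fun s q' => by
    rw [measureReal_compl (hAm s q'), probReal_univ]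
  have hq1 : μ.real (A 1 q) > 7 / 8 := by rw [hc] at hq; linarith
  have hq2 : μ.real (A (-1) (-q.1, q.2)) > 7 / 8 := lt_of_lt_of_le hq1 (hv 1 q)
  have hq3 : μ.real (A 1 (-q.1, -q.2)) > 7 / 8 := by
    have := hh (-1) (-q.1, q.2); simp only [neg_neg] at this; exact lt_of_lt_of_le hq2 this
  have hq4 : μ.real (A (-1) (q.1, -q.2)) > 7 / 8 := by
    have := hv 1 (-q.1, -q.2); simp only [neg_neg] at this; exact lt_of_lt_of_le hq3 this
  -- union bound: the six events occur simultaneously with positive probability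
  set Good : Set (SpinConfig (Site 2)) := A 1 q ∩ A (-1) (-q.1, q.2) ∩ A 1 (-q.1, -q.2) ∩ A (-1) (q.1, -q.2) ∩
    localUnique 1 m N ∩ localUnique (-1) m N with hGood
  have hGood_pos : 0 < μ.real Good := by
    have hU1 := measurableSet_localUnique 1 m N
    have hU2 := measurableSet_localUnique (-1) m N
    have key : μ.real Goodᶜ < 1 := by
      have hsub : Goodᶜ ⊆ (A 1 q)ᶜ ∪ (A (-1) (-q.1, q.2))ᶜ ∪ (A 1 (-q.1, -q.2))ᶜ ∪ (A (-1) (q.1, -q.2))ᶜ ∪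
          (localUnique 1 m N)ᶜ ∪ (localUnique (-1) m N)ᶜ := by
        intro ω hω
        simp only [hGood, Set.mem_compl_iff, Set.mem_inter_iff, not_and_or] at hω
        simp only [Set.mem_union, Set.mem_compl_iff]
        tauto
      have hcU1 : μ.real (localUnique 1 m N)ᶜ < 1 / 8 := by
        rw [measureReal_compl hU1, probReal_univ]; linarith
      have hcU2 : μ.real (localUnique (-1) m N)ᶜ < 1 / 8 := by
        rw [measureReal_compl hU2, probReal_univ]; linarith
      have u2 := measureReal_union_le (μ := μ) (A 1 q)ᶜ (A (-1) (-q.1, q.2))ᶜ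
      have u3 := measureReal_union_le (μ := μ) ((A 1 q)ᶜ ∪ (A (-1) (-q.1, q.2))ᶜ) (A 1 (-q.1, -q.2))ᶜ
      have u4 := measureReal_union_le (μ := μ) ((A 1 q)ᶜ ∪ (A (-1) (-q.1, q.2))ᶜ ∪ (A 1 (-q.1, -q.2))ᶜ)
        (A (-1) (q.1, -q.2))ᶜ
      have u5 := measureReal_union_le (μ := μ)
        ((A 1 q)ᶜ ∪ (A (-1) (-q.1, q.2))ᶜ ∪ (A 1 (-q.1, -q.2))ᶜ ∪ (A (-1) (q.1, -q.2))ᶜ) (localUnique 1 m N)ᶜ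
      have u6 := measureReal_union_le (μ := μ)
        ((A 1 q)ᶜ ∪ (A (-1) (-q.1, q.2))ᶜ ∪ (A 1 (-q.1, -q.2))ᶜ ∪ (A (-1) (q.1, -q.2))ᶜ ∪ (localUnique 1 m N)ᶜ)
        (localUnique (-1) m N)ᶜ
      have h4c : μ.real (A 1 q)ᶜ + μ.real (A (-1) (-q.1, q.2))ᶜ + μ.real (A 1 (-q.1, -q.2))ᶜ +
          μ.real (A (-1) (q.1, -q.2))ᶜ < 4 / 8 := by rw [hc, hc, hc, hc]; linarith
      have := measureReal_mono (μ := μ) hsub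
      linarith
    have hGm : MeasurableSet Good := by
      rw [hGood]
      exact (((((hAm _ _).inter (hAm _ _)).inter (hAm _ _)).inter (hAm _ _)).inter hU1).inter hU2
    rw [measureReal_compl hGm, probReal_univ] at key
    linarith
  obtain ⟨ω, hω⟩ : Good.Nonempty :=
    nonempty_of_measure_ne_zero (by
      intro h0
      rw [measureReal_def, h0, ENNReal.toReal_zero] at hGood_pos
      exact lt_irrefl _ hGood_pos)
  -- the endgame
  obtain ⟨⟨⟨⟨⟨hA1, hA2⟩, hA3⟩, hA4⟩, hU1⟩, hU2⟩ := hω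
  obtain ⟨x₁, hx₁, hinf₁, e₁, he₁, hc₁⟩ := hA1
  obtain ⟨x₃, hx₃, hinf₃, e₃, he₃, hc₃⟩ := hA3
  obtain ⟨x₂, hx₂, hinf₂, e₂, he₂, hc₂⟩ := hA2
  obtain ⟨x₄, hx₄, hinf₄, e₄, he₄, hc₄⟩ := hA4
  have h13 : boxConn 1 N ω x₁ x₃ := hU1 x₁ hx₁ x₃ hx₃ hinf₁ hinf₃
  have h24 : boxConn (-1) N ω x₂ x₄ := hU2 x₂ hx₂ x₄ hx₄ hinf₂ hinf₄
  have hP : boxConn 1 N ω e₁ e₃ := (hc₁.symm.trans h13).trans hc₃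
  have hQ : boxConn (-1) N ω e₂ e₄ := (hc₂.symm.trans h24).trans hc₄
  have hxS : ∀ {s : ℤˣ} {x : Site 2}, x ∈ box 2 m →
      (siteCluster (zdGraph 2) (spinSites s ω) x).Infinite → x ∈ spinSites s ω ∩ ↑(box 2 N) :=
    fun hx hinf => ⟨mem_spinSites_of_infinite hinf, Finset.mem_coe.2 (box_mono 2 hNm hx)⟩
  have he₁S : e₁ ∈ spinSites 1 ω ∩ ↑(box 2 N) := mem_of_boxConn hc₁ (hxS hx₁ hinf₁)
  have he₂S : e₂ ∈ spinSites (-1) ω ∩ ↑(box 2 N) := mem_of_boxConn hc₂ (hxS hx₂ hinf₂)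
  obtain ⟨P⟩ := hP
  obtain ⟨Q⟩ := hQ
  have hle : ∀ O : Set (Site 2), siteOpenGraph (zdGraph 2) O ≤ zdGraph 2 := fun O a b hab =>
    ((siteOpenGraph_adj _ _ _ _).1 hab).1
  refine false_of_crossing_arms (N := N) (ω := ω) q he₁ he₃ he₂ he₄ (P.mapLe (hle _)) (Q.mapLe (hle _))
    (fun z hz => ?_) (fun z hz => ?_)
  · rw [Walk.support_mapLe_eq_support] at hz
    exact support_subset_of_walk_siteOpenGraph P he₁S z hz
  · rw [Walk.support_mapLe_eq_support] at hz
    exact support_subset_of_walk_siteOpenGraph Q he₂S z hz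

end Assembly

end Literature.Probability.LatticeModels
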